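import Summits.QuantumFields.YangMills.Theorems.LuscherReductionTwistedTraceScalingBODefectOutPiece
import Summits.QuantumFields.YangMills.Theorems.LuscherReductionTwistedTraceScalingBTTubeMagnetic
import Summits.QuantumFields.YangMills.Theorems.LuscherReductionTwistedTraceScalingFloorTube
import Summits.QuantumFields.YangMills.Theorems.LuscherReductionTwistedTraceScalingBORecordSupport
import Summits.QuantumFields.YangMills.Theorems.ToronSmallBallLargeFieldCut
import HarnessLib

/-!
# R59 — THE `hsep` HYPOTHESIS OF `…BODefectOutPiece.out_sq_integral_le_of_sep` IS DISCHARGED BY THE MAGNETIC FACTOR OF THE KERNEL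

Lane A's (C5) outer piece (`…BODefectOutPiece`, ✓p722548) bounds `∫ g_near·F_in²` GIVEN a "stiff-separation" kernel bound
```
hsep : ∀ U ∈ orthoTubeSet L ∩ {recordChi ≠ 0} ∩ {R₀ < ‖relLinkVec U‖}, ‖P_Γ(relLinkVec U)‖ ≤ τ →
       ∀ V ∈ orthoTubeSet L ∩ {‖relLinkVec V‖ ≤ R₀/2} ∩ {‖P_Γ(relLinkVec V)‖ ≤ τ} ∩ {slow window δ}, avgKernel β U V ≤ K_sep
```
and its card `Lines-stiff-separation.md` (S1–S9) reduces `hsep` to a KINETIC separation `kinDefect U V g ≥ d₀²` for every gauge transformation `g`, through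
`transferKernel_gaugeTransform_le` (`K_β(U,V^g) ≤ e^{2β|E| − β·kinDefect}`), which DROPS the magnetic Boltzmann factor.

THIS FILE (kernel-checked, def-free): keep the magnetic factor instead.
* §1 ★★ `avgKernel_le_magnetic`: the landed pointwise bound `…FemtoTransferGap.TT.transferKernel_le_exp_mul_expAction_left` (`transferKernel_eq_latE_mul` + `latE_le`) gives, for `β ≥ 0` and EVERY `V`,
  `K̃_β(U,V) = ∫ K_β(U,V^g) dg ≤ e^{2β|E|}·e^{−(β/2)·S(U)}` — no hypothesis on `V` whatsoever (`avgKernel_le_of_wilsonAction_ge`: `A ≤ S(U) ⇒ K̃ ≤ e^{2β|E|}e^{−βA/2}`).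
* §2 ★★ `wilsonAction_orthoTube_ge_sq`: on the outer gauge-near tube the Wilson action is bounded BELOW by the squared fluctuation radius,
  `S(orthoTube u x) ≥ (gap/16)·‖linkEmbed x‖²`, `gap = 2 − 2cos(2π/L)` (`L ≥ 2`), from `wilsonAction_orthoTube_ge` (`L³S₁(u) + (1−σ/2)‖D_u x‖² − E ≤ S`),
  `norm_covCurl_sub_vacuum_le` (`‖D_u x − D_1 x‖ ≤ 504τ_u√N‖x‖`), `gaugeModes_le_ker` (`D_1 P_Γ x = 0`), the vacuum Hodge theorem (H) `ker_covCurl_one_le` with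
  `sub_starProjection_mem_stiffSpace_of_hodge` + `stiff_coercive` (`gap·‖x − P_Γx‖² ≤ ‖D_1 x‖²`, `x ⟂ constModes` because `x` is balanced), and `‖P_Γ x‖ ≤ ‖x‖/2`;
  the smallness asked is `σ ≤ 1`, `504τ_u√N ≤ √gap/8`, `‖x‖ ≤ ρ ≤ 1/30`, `|P|(1728√σ + 29376ρ + 700569ρ²) ≤ gap/128`.
* §3 ★★★ `hsep_of_magnetic`: `hsep` in the LITERAL binder shape of `out_sq_integral_le_of_sep`, β-pointwise, with `K_sep = e^{2β|E|}·e^{−(β/2)(gap/16)R₀²}`, from a-priori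
  bounds on the `U`-set (slow entries `≤ τ_u`, `L³S(slowMean U) ≤ σ`, `‖relLinkVec U‖ ≤ ρ`) and `2τ ≤ R₀`.
* §4 ★★★ `eventually_hsep_magnetic`: for the record weight (`recordChi_support`: links within `43Mβ^{-s}` of `1`, slow mean within `517β^{-s}/|Site|`,
  `L³S₁ ≤ β^{-2s}`) ALL the smallness holds eventually, for EVERY `s > 0`; the only schedule hypothesis left is `∀ᶠ β, 2τ_β ≤ R₀(β)`.
  On schedule B (`R₀ = r_f/12`, `βR₀² = ℓ²/144` eventually) `K_sep = e^{2β|E|}·e^{−gap·ℓ²/4608}`: the shape `e^{2β|E|}·X`, `X·poly(β) → 0`, that the (B-OD) rate wants.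

READING (the disprover's ledger, cycle 47): the typed (C5) target `hsep` is TRUE and cheap; the kinetic (SEP) programme (S1–S9, the `s > 1/6` window of S8′, the bootstrap S6′)
is not load-bearing for `I_out` — NO KILL is available in the outer piece.  What remains priced but open: the hOD assembly (γ) against the R58 frozen-profile floor, the currency
floor (β), (B-ST).
HONEST FRAMING: a positive helper for one hypothesis of one piece of a stub (`TwistedTraceScaling`, stmt-QuantumFields-20203) of a child of the CONDITIONAL reduction route
R2b1; nothing is refuted; not infinite volume, not a mass gap, not Clay.
-/

set_option autoImplicit false

noncomputable section

open MeasureTheory Filter Topology Real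
open scoped BigOperators RealInnerProductSpace
open Literature.MathematicalPhysics.QuantumFieldTheory hiding SU2
open Literature.MathematicalPhysics.QuantumLattice
open Summit.QuantumFields.YangMills.Theorems.FemtoTransferGap
open Summit.QuantumFields.YangMills.Theorems.FemtoTransferGap.TwoLattice
open Summit.QuantumFields.YangMills.Theorems.FemtoTransferGap.TwoLattice.Avg
open Summit.QuantumFields.YangMills.Theorems.FemtoTransferGap.TwoLattice.Stiff
open Summit.QuantumFields.YangMills.Theorems.FemtoTransferGap.TwoLattice.Cov
open Summit.QuantumFields.YangMills.Theorems.FemtoTransferGap.TwoLattice.Toron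
open Summit.QuantumFields.YangMills.Theorems.FemtoTransferGap.TwoLattice.ConstTube

namespace Summit.QuantumFields.YangMills.Theorems.TwistedTraceScaling.Negative.R59

variable {L : ℕ} [NeZero L]

/-! ## §1 The magnetic factor: `K̃_β(U,V) ≤ e^{2β|E|}·e^{−(β/2)S(U)}` for every `V` -/

/-- ★★ **`K̃_β(U,V) ≤ e^{2β|E|}·e^{−(β/2)·S(U)}` for EVERY `V`** (`β ≥ 0`): gauge averaging acts on `V` only, and `S(V^g) ≥ 0`. [cite: SeilerLNP1982, §3] -/
theorem avgKernel_le_magnetic {β : ℝ} (hβ : 0 ≤ β) (U V : GaugeConfig 3 L SU2) :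
    avgKernel β U V ≤ Real.exp (2 * β) ^ Fintype.card (Edge 3 L) * Real.exp (-(β / 2) * wilsonAction su2Rep U) := by
  unfold avgKernel
  have h := integral_mono (integrable_transferKernel_gaugeTransform_right β U V) (integrable_const _)
    fun g => TT.transferKernel_le_exp_mul_expAction_left hβ U (gaugeTransform g V)
  simpa [integral_const] using h

/-- `A ≤ S(U) ⇒ K̃_β(U,V) ≤ e^{2β|E|}·e^{−βA/2}` for every `V` (`β ≥ 0`). [folklore] -/
theorem avgKernel_le_of_wilsonAction_ge {β A : ℝ} (hβ : 0 ≤ β) {U : GaugeConfig 3 L SU2} (hA : A ≤ wilsonAction su2Rep U) (V : GaugeConfig 3 L SU2) :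
    avgKernel β U V ≤ Real.exp (2 * β) ^ Fintype.card (Edge 3 L) * Real.exp (-(β / 2 * A)) :=
  (avgKernel_le_magnetic hβ U V).trans (mul_le_mul_of_nonneg_left (Real.exp_le_exp.2 (by nlinarith)) (by positivity))

/-! ## §2 The Wilson action on the outer gauge-near tube is bounded below by the squared fluctuation radius -/

/-- Entries are bounded by the Euclidean norm: `|x_{e,c}| ≤ ‖linkEmbed x‖`. [folklore] -/
theorem abs_entry_le_norm_linkEmbed (x : Edge 3 L → Fin 3 → ℝ) (e : Edge 3 L) (c : Fin 3) : |x e c| ≤ ‖linkEmbed L x‖ := by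
  have h := PiLp.norm_apply_le (linkEmbed L x) (e, c)
  rwa [Real.norm_eq_abs, linkEmbed_apply] at h

/-- `‖D_1 x‖ ≥ √gap·(‖x‖ − ‖P_Γ x‖)` for balanced `x` (`L ≥ 2`): Hodge (H) + stiff coercivity + `D_1 P_Γ = 0`. [cite: Luscher1983, §3] -/
theorem sqrt_gap_mul_le_norm_covCurl_one (hL : 2 ≤ L) {x : Edge 3 L → Fin 3 → ℝ} (hx : x ∈ balancedSet L) :
    Real.sqrt (2 - 2 * Real.cos (2 * Real.pi / L)) * (‖linkEmbed L x‖ - ‖(gaugeModes L).starProjection (linkEmbed L x)‖) ≤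
      ‖covCurl (1 : GaugeConfig 3 L SU2) (linkEmbed L x)‖ := by
  set gap : ℝ := 2 - 2 * Real.cos (2 * Real.pi / L) with hgapdef
  set X : LinkSpace L := linkEmbed L x with hXdef
  set P : LinkSpace L := (gaugeModes L).starProjection X with hPdef
  have hgap : 0 < gap := gap_pos L hL
  have hXc : ∀ c ∈ constModes L, ⟪c, X⟫ = 0 := fun c hc => inner_constMode_linkEmbed_eq_zero hc hx
  have hyS : X - P ∈ stiffSpace L := sub_starProjection_mem_stiffSpace_of_hodge ker_covCurl_one_le hXc
  have hcoer := stiff_coercive hL hyS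
  have hker : covCurl (1 : GaugeConfig 3 L SU2) P = 0 := by
    have h := gaugeModes_le_ker (L := L) (Submodule.starProjection_apply_mem (gaugeModes L) X)
    rwa [LinearMap.mem_ker] at h
  have hD1 : covCurl (1 : GaugeConfig 3 L SU2) (X - P) = covCurl (1 : GaugeConfig 3 L SU2) X := by rw [map_sub, hker, sub_zero]
  rw [hD1] at hcoer
  -- `√gap·‖X − P‖ ≤ ‖D_1 X‖`
  have h1 : (Real.sqrt gap * ‖X - P‖) ^ 2 ≤ ‖covCurl (1 : GaugeConfig 3 L SU2) X‖ ^ 2 := by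
    rw [mul_pow, Real.sq_sqrt hgap.le]; exact hcoer
  have h2 : Real.sqrt gap * ‖X - P‖ ≤ ‖covCurl (1 : GaugeConfig 3 L SU2) X‖ :=
    (pow_le_pow_iff_left₀ (by positivity) (norm_nonneg _) two_ne_zero).mp h1
  have h3 : ‖X‖ - ‖P‖ ≤ ‖X - P‖ := norm_sub_norm_le X P
  calc Real.sqrt gap * (‖X‖ - ‖P‖) ≤ Real.sqrt gap * ‖X - P‖ := mul_le_mul_of_nonneg_left h3 (Real.sqrt_nonneg _)
    _ ≤ _ := h2

/-- `‖linkEmbed x‖ ≤ √|E × Fin 3|·t` when every entry is `≤ t` (`t ≥ 0`). [folklore] -/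
theorem norm_linkEmbed_le_of_entry_le {x : Edge 3 L → Fin 3 → ℝ} {t : ℝ} (ht : 0 ≤ t) (h : ∀ (e : Edge 3 L) (c : Fin 3), |x e c| ≤ t) :
    ‖linkEmbed L x‖ ≤ Real.sqrt (Fintype.card (Edge 3 L × Fin 3)) * t := by
  have h2 : ‖linkEmbed L x‖ ^ 2 ≤ (Real.sqrt (Fintype.card (Edge 3 L × Fin 3)) * t) ^ 2 := by
    rw [EuclideanSpace.norm_sq_eq, mul_pow, Real.sq_sqrt (Nat.cast_nonneg _)]
    calc ∑ i, ‖linkEmbed L x i‖ ^ 2 ≤ ∑ _i : Edge 3 L × Fin 3, t ^ 2 := Finset.sum_le_sum fun i _ => by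
            rw [Real.norm_eq_abs, linkEmbed_apply]; exact pow_le_pow_left₀ (abs_nonneg _) (h i.1 i.2) 2
      _ = (Fintype.card (Edge 3 L × Fin 3) : ℝ) * t ^ 2 := by rw [Finset.sum_const, Finset.card_univ, nsmul_eq_mul]
  exact (pow_le_pow_iff_left₀ (norm_nonneg _) (by positivity) two_ne_zero).mp h2

/-- ★★ **THE ACTION FLOOR ON THE OUTER GAUGE-NEAR TUBE**: for `L ≥ 2`, `x ∈ capBalancedSet L`, slow links with vector parts `≤ τ_u ≤ 1` and `504τ_u√N ≤ √gap/8`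
(`N = |P × Fin 3|`), `L³S₁(u) ≤ σ ≤ 1`, `‖linkEmbed x‖ ≤ ρ ≤ 1/30`, `|P|(1728√σ + 29376ρ + 700569ρ²) ≤ gap/128`, and `‖P_Γ(linkEmbed x)‖ ≤ ‖linkEmbed x‖/2`:
`(gap/16)·‖linkEmbed x‖² ≤ S(orthoTube u x)`, `gap = 2 − 2cos(2π/L)`. [cite: Luscher1983, §3] -/
theorem wilsonAction_orthoTube_ge_sq (hL : 2 ≤ L) (u : GaugeConfig 3 1 SU2) {x : Edge 3 L → Fin 3 → ℝ} (hx : x ∈ capBalancedSet L)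
    {τu σ ρ : ℝ} (hτu1 : τu ≤ 1) (hu : ∀ (k : Fin 3) (c : Fin 3), |vecPart (u (0, k)) c| ≤ τu)
    (hτu : 504 * τu * Real.sqrt (Fintype.card (Plaquette 3 L × Fin 3)) ≤ Real.sqrt (2 - 2 * Real.cos (2 * Real.pi / L)) / 8)
    (hσ1 : σ ≤ 1) (hS : (L : ℝ) ^ 3 * wilsonAction su2Rep u ≤ σ)
    (hρ : ‖linkEmbed L x‖ ≤ ρ) (hρ1 : ρ ≤ 1 / 30)
    (herr : (Fintype.card (Plaquette 3 L) : ℝ) * (1728 * Real.sqrt σ + 29376 * ρ + 700569 * ρ ^ 2) ≤ (2 - 2 * Real.cos (2 * Real.pi / L)) / 128)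
    (hΓ : ‖(gaugeModes L).starProjection (linkEmbed L x)‖ ≤ ‖linkEmbed L x‖ / 2) :
    (2 - 2 * Real.cos (2 * Real.pi / L)) / 16 * ‖linkEmbed L x‖ ^ 2 ≤ wilsonAction su2Rep (orthoTube L u x) := by
  set gap : ℝ := 2 - 2 * Real.cos (2 * Real.pi / L) with hgapdef
  set X : LinkSpace L := linkEmbed L x with hXdef
  have hgap : 0 < gap := gap_pos L hL
  have hX0 : 0 ≤ ‖X‖ := norm_nonneg _
  have hρ0 : 0 ≤ ρ := hX0.trans hρ
  -- (a) the vacuum curl: `‖D_1 X‖ ≥ √gap·‖X‖/2`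
  have hD1 : Real.sqrt gap * ‖X‖ / 2 ≤ ‖covCurl (1 : GaugeConfig 3 L SU2) X‖ := by
    have h := sqrt_gap_mul_le_norm_covCurl_one hL hx.1
    have h' : Real.sqrt gap * (‖X‖ / 2) ≤ Real.sqrt gap * (‖X‖ - ‖(gaugeModes L).starProjection X‖) :=
      mul_le_mul_of_nonneg_left (by linarith) (Real.sqrt_nonneg _)
    linarith
  -- (b) the covariant curl of the constant lift: `‖D_u X − D_1 X‖ ≤ 504τ_u√N‖X‖ ≤ √gap‖X‖/8`, so `‖D_u X‖ ≥ 3√gap‖X‖/8`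
  have hw : ∀ (e : Edge 3 L) (c : Fin 3), |vecPart (constLift L u e) c| ≤ τu := fun e c => by rw [constLift_apply]; exact hu e.2 c
  have hdiff : ‖covCurl (constLift L u) X - covCurl (1 : GaugeConfig 3 L SU2) X‖ ≤ Real.sqrt gap / 8 * ‖X‖ :=
    (norm_covCurl_sub_vacuum_le hτu1 hw X).trans (mul_le_mul_of_nonneg_right hτu hX0)
  have hDu : 3 * Real.sqrt gap * ‖X‖ / 8 ≤ ‖covCurl (constLift L u) X‖ := by
    have h := norm_sub_norm_le (covCurl (1 : GaugeConfig 3 L SU2) X) (covCurl (constLift L u) X)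
    rw [← norm_sub_rev (covCurl (constLift L u) X)] at h
    linarith
  have hDu2 : 9 * gap * ‖X‖ ^ 2 / 64 ≤ ‖covCurl (constLift L u) X‖ ^ 2 := by
    have h0 : 0 ≤ 3 * Real.sqrt gap * ‖X‖ / 8 := by positivity
    have h := pow_le_pow_left₀ h0 hDu 2
    have e : (3 * Real.sqrt gap * ‖X‖ / 8) ^ 2 = 9 * gap * ‖X‖ ^ 2 / 64 := by
      rw [div_pow, mul_pow, mul_pow, Real.sq_sqrt hgap.le]; ring
    rwa [e] at h
  -- (c) the tube bound with entry bound `τ := ‖X‖` and its error term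
  have hxX : ∀ (e : Edge 3 L) (c : Fin 3), |x e c| ≤ ‖X‖ := fun e c => abs_entry_le_norm_linkEmbed x e c
  have hX30 : ‖X‖ ≤ 1 / 30 := hρ.trans hρ1
  have hσ2 : σ < 2 := by linarith
  have hge := wilsonAction_orthoTube_ge u hx hX30 hσ2 hS hxX
  have herr' : stepActionErr (L := L) ‖X‖ σ ≤ gap / 128 * ‖X‖ ^ 2 := by
    have hP : 0 ≤ (Fintype.card (Plaquette 3 L) : ℝ) := Nat.cast_nonneg _
    have hsq : 0 ≤ Real.sqrt σ := Real.sqrt_nonneg _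
    have e : stepActionErr (L := L) ‖X‖ σ = (Fintype.card (Plaquette 3 L) : ℝ) * (1728 * Real.sqrt σ + 29376 * ‖X‖ + 700569 * ‖X‖ ^ 2) * ‖X‖ ^ 2 := by
      unfold stepActionErr; ring
    rw [e]
    refine mul_le_mul_of_nonneg_right ?_ (sq_nonneg _)
    calc (Fintype.card (Plaquette 3 L) : ℝ) * (1728 * Real.sqrt σ + 29376 * ‖X‖ + 700569 * ‖X‖ ^ 2)
        ≤ (Fintype.card (Plaquette 3 L) : ℝ) * (1728 * Real.sqrt σ + 29376 * ρ + 700569 * ρ ^ 2) := by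
          refine mul_le_mul_of_nonneg_left ?_ hP
          nlinarith [pow_le_pow_left₀ hX0 hρ 2]
      _ ≤ gap / 128 := herr
  -- assemble
  have hS0 : 0 ≤ (L : ℝ) ^ 3 * wilsonAction su2Rep u := mul_nonneg (by positivity) (wilsonAction_su2_nonneg_lat u)
  have h1σ : 1 / 2 ≤ 1 - σ / 2 := by linarith
  have hmid : 1 / 2 * (9 * gap * ‖X‖ ^ 2 / 64) ≤ (1 - σ / 2) * ‖covCurl (constLift L u) X‖ ^ 2 :=
    mul_le_mul h1σ hDu2 (by positivity) (by linarith)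
  calc gap / 16 * ‖X‖ ^ 2 = 0 + 1 / 2 * (9 * gap * ‖X‖ ^ 2 / 64) - gap / 128 * ‖X‖ ^ 2 := by ring
    _ ≤ (L : ℝ) ^ 3 * wilsonAction su2Rep u + (1 - σ / 2) * ‖covCurl (constLift L u) X‖ ^ 2 - stepActionErr (L := L) ‖X‖ σ := by
        linarith [hS0, herr', hmid]
    _ ≤ wilsonAction su2Rep (orthoTube L u x) := hge

/-! ## §3 ★★★ `hsep`, β-pointwise, in the literal shape of `out_sq_integral_le_of_sep` -/

/-- ★★★ **`hsep` FROM THE MAGNETIC FACTOR** (β-pointwise).  Let `L ≥ 2`, `β ≥ 0`, and suppose every `U ∈ orthoTubeSet L` with `recordChi L s 43 M β U ≠ 0` has slow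
vector parts `≤ τ_u`, `L³·S(slowMean U) ≤ σ` and `‖relLinkVec U‖ ≤ ρ`, with the smallness `τ_u ≤ 1`, `504τ_u√|P×Fin 3| ≤ √gap/8`, `σ ≤ 1`, `ρ ≤ 1/30`,
`|P|(1728√σ + 29376ρ + 700569ρ²) ≤ gap/128`, and `2τ ≤ R₀`.  Then the hypothesis `hsep` of `…BODefectOutPiece.out_sq_integral_le_of_sep` holds with
`K_sep = e^{2β|E|}·exp(−(β/2)·(gap/16)·R₀²)` (`gap = 2 − 2cos(2π/L)`) — for EVERY `V` (the `V`-window is not used). [cite: Luscher1983, §3] [cite: SeilerLNP1982, §3] -/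
theorem hsep_of_magnetic (hL : 2 ≤ L) {β : ℝ} (hβ : 0 ≤ β) {s M τu σ ρ R₀ τ δ : ℝ}
    (hτu1 : τu ≤ 1) (hτu : 504 * τu * Real.sqrt (Fintype.card (Plaquette 3 L × Fin 3)) ≤ Real.sqrt (2 - 2 * Real.cos (2 * Real.pi / L)) / 8)
    (hσ1 : σ ≤ 1) (hρ1 : ρ ≤ 1 / 30)
    (herr : (Fintype.card (Plaquette 3 L) : ℝ) * (1728 * Real.sqrt σ + 29376 * ρ + 700569 * ρ ^ 2) ≤ (2 - 2 * Real.cos (2 * Real.pi / L)) / 128)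
    (h2τ : 2 * τ ≤ R₀)
    (hrec : ∀ U ∈ orthoTubeSet L, recordChi L s 43 M β U ≠ 0 →
      (∀ (k : Fin 3) (c : Fin 3), |vecPart (slowMean L U (0, k)) c| ≤ τu) ∧ (L : ℝ) ^ 3 * wilsonAction su2Rep (slowMean L U) ≤ σ ∧ ‖relLinkVec L U‖ ≤ ρ) :
    ∀ U ∈ orthoTubeSet L ∩ {U | recordChi L s 43 M β U ≠ 0} ∩ {U | R₀ < ‖relLinkVec L U‖}, ‖(gaugeModes L).starProjection (relLinkVec L U)‖ ≤ τ →
      ∀ V ∈ orthoTubeSet L ∩ {V | ‖relLinkVec L V‖ ≤ R₀ / 2} ∩ {V | ‖(gaugeModes L).starProjection (relLinkVec L V)‖ ≤ τ} ∩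
          {V | ∀ k : Fin 3, ‖su2Quat (slowMean L V (0, k)) - 1‖ ≤ δ},
        avgKernel β U V ≤ Real.exp (2 * β) ^ Fintype.card (Edge 3 L) * Real.exp (-(β / 2 * ((2 - 2 * Real.cos (2 * Real.pi / L)) / 16 * R₀ ^ 2))) := by
  intro U hU hUΓ V _
  obtain ⟨⟨hUT, hUχ⟩, hUR⟩ := hU
  obtain ⟨hu, hSu, hρU⟩ := hrec U hUT hUχ
  obtain ⟨u, x, hx, rfl⟩ := hUT
  rw [slowMean_orthoTube L u hx] at hu hSu
  simp only [Set.mem_setOf_eq, relLinkVec_orthoTube L u hx] at hρU hUR hUΓ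
  have hR0 : 0 ≤ R₀ := by linarith [norm_nonneg ((gaugeModes L).starProjection (linkEmbed L x))]
  have hΓ : ‖(gaugeModes L).starProjection (linkEmbed L x)‖ ≤ ‖linkEmbed L x‖ / 2 := by linarith
  have hfloor := wilsonAction_orthoTube_ge_sq hL u hx hτu1 hu hτu hσ1 hSu hρU hρ1 herr hΓ
  have hsq : R₀ ^ 2 ≤ ‖linkEmbed L x‖ ^ 2 := pow_le_pow_left₀ hR0 hUR.le 2
  have hg : 0 ≤ (2 - 2 * Real.cos (2 * Real.pi / L)) / 16 := by have := gap_pos L hL; positivity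
  exact avgKernel_le_of_wilsonAction_ge hβ ((mul_le_mul_of_nonneg_left hsq hg).trans hfloor) V

/-! ## §4 ★★★ Eventually in `β`: all the smallness holds on the record support, for every `s > 0` -/

/-- `√(powScale (2s) β) = powScale s β`. [folklore] -/
theorem sqrt_powScale_two_mul (s β : ℝ) : Real.sqrt (powScale (2 * s) β) = powScale s β := by
  have h : powScale (2 * s) β = powScale s β ^ 2 := by rw [two_mul, sq, powScale_mul_powScale]
  rw [h, Real.sqrt_sq (powScale_pos s β).le]

/-- On the record support the relative coordinates are small: for `U = orthoTube u x` with links within `a` of `1` and slow links within `b` of `1`,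
every entry satisfies `|x_{e,c}| ≤ a + b`. [folklore] -/
theorem abs_entry_le_of_links {u : GaugeConfig 3 1 SU2} {x : Edge 3 L → Fin 3 → ℝ} (hx : x ∈ capBalancedSet L) {a b : ℝ}
    (hlink : ∀ e : Edge 3 L, ‖su2Quat (orthoTube L u x e) - 1‖ ≤ a) (hslow : ∀ k : Fin 3, ‖su2Quat (u (0, k)) - 1‖ ≤ b) (e : Edge 3 L) (c : Fin 3) :
    |x e c| ≤ a + b := by
  have hcap : ∑ a, x e a ^ 2 ≤ 1 := sum_sq_le_one_of_cap L hx.2 e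
  have h1 : x e c = vecPart (orthoTube L u x e * (u (0, e.2))⁻¹) c := by rw [orthoTube_apply, mul_inv_cancel_right, vecPart_chartSU2 hcap]
  rw [h1]
  calc |vecPart (orthoTube L u x e * (u (0, e.2))⁻¹) c| ≤ ‖su2Quat (orthoTube L u x e * (u (0, e.2))⁻¹) - 1‖ := abs_vecPart_le_norm_sub_one _ c
    _ = ‖su2Quat (orthoTube L u x e) - su2Quat (u (0, e.2))‖ := norm_su2Quat_mul_inv_sub_one _ _
    _ ≤ ‖su2Quat (orthoTube L u x e) - 1‖ + ‖(1 : Quaternion ℝ) - su2Quat (u (0, e.2))‖ := norm_sub_le_norm_sub_add_norm_sub _ _ _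
    _ ≤ a + b := add_le_add (hlink e) (by rw [norm_sub_rev]; exact hslow e.2)

/-- ★★★ **`hsep` FOR THE RECORD WEIGHT, EVENTUALLY IN `β`, FOR EVERY `s > 0`.**  For `L ≥ 2`, `s > 0`, `M ≥ 0` and ANY schedules `R₀, τ, δ : ℝ → ℝ` with `2τ_β ≤ R₀(β)`
eventually, the hypothesis `hsep` of `…BODefectOutPiece.out_sq_integral_le_of_sep` holds eventually with `K_sep(β) = e^{2β|E|}·exp(−(β/2)·(gap/16)·R₀(β)²)`: all the
a-priori smallness (slow vector parts `≤ 517β^{-s}/|Site|`, `L³S₁ ≤ β^{-2s}`, `‖relLinkVec U‖ ≤ √|E×Fin 3|·(43M + 517/|Site|)β^{-s}`) comes from `recordChi_support`.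
On schedule B (`R₀ = r_f/12`, `r_f = β^{-1/2}ℓ` eventually) this is `K_sep = e^{2β|E|}·e^{−gap·ℓ²/4608}` — superpolynomially small against `e^{2β|E|}`; no kinetic
separation, no `g`-analysis, no window `s > 1/6` is used. [cite: Luscher1983, §3] [cite: SeilerLNP1982, §3] -/
theorem eventually_hsep_magnetic (hL : 2 ≤ L) {s : ℝ} (hs : 0 < s) {M : ℝ} (hM : 0 ≤ M) (R₀ τ δ : ℝ → ℝ)
    (h2τ : ∀ᶠ β : ℝ in atTop, 2 * τ β ≤ R₀ β) :
    ∀ᶠ β : ℝ in atTop,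
      ∀ U ∈ orthoTubeSet L ∩ {U | recordChi L s 43 M β U ≠ 0} ∩ {U | R₀ β < ‖relLinkVec L U‖}, ‖(gaugeModes L).starProjection (relLinkVec L U)‖ ≤ τ β →
        ∀ V ∈ orthoTubeSet L ∩ {V | ‖relLinkVec L V‖ ≤ R₀ β / 2} ∩ {V | ‖(gaugeModes L).starProjection (relLinkVec L V)‖ ≤ τ β} ∩
            {V | ∀ k : Fin 3, ‖su2Quat (slowMean L V (0, k)) - 1‖ ≤ δ β},
          avgKernel β U V ≤ Real.exp (2 * β) ^ Fintype.card (Edge 3 L) * Real.exp (-(β / 2 * ((2 - 2 * Real.cos (2 * Real.pi / L)) / 16 * R₀ β ^ 2))) := by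
  set gap : ℝ := 2 - 2 * Real.cos (2 * Real.pi / L) with hgapdef
  have hgap : 0 < gap := gap_pos L hL
  set NS : ℝ := (Fintype.card (Site 3 L) : ℝ) with hNSdef
  set n : ℝ := (Fintype.card (Edge 3 L × Fin 3) : ℝ) with hndef
  set NP : ℝ := (Fintype.card (Plaquette 3 L × Fin 3) : ℝ) with hNPdef
  set P : ℝ := (Fintype.card (Plaquette 3 L) : ℝ) with hPdef
  -- the a-priori schedules
  set τu : ℝ → ℝ := fun β => 517 / NS * powScale s β with hτudef
  set ρ : ℝ → ℝ := fun β => Real.sqrt n * ((M * 43 + 517 / NS) * powScale s β) with hρdef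
  have hps : Tendsto (powScale s) atTop (𝓝 0) := tendsto_powScale hs
  have Tτu : Tendsto τu atTop (𝓝 0) := by simpa [hτudef] using hps.const_mul (517 / NS)
  have T2 : Tendsto (fun β => 504 * τu β * Real.sqrt NP) atTop (𝓝 0) := by simpa using (Tτu.const_mul 504).mul_const (Real.sqrt NP)
  have Tρ : Tendsto ρ atTop (𝓝 0) := by simpa [hρdef] using (hps.const_mul (M * 43 + 517 / NS)).const_mul (Real.sqrt n)
  have T5 : Tendsto (fun β => P * (1728 * powScale s β + 29376 * ρ β + 700569 * ρ β ^ 2)) atTop (𝓝 0) := by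
    have h := (((hps.const_mul 1728).add (Tρ.const_mul 29376)).add ((Tρ.pow 2).const_mul 700569)).const_mul P
    have e : P * (1728 * 0 + 29376 * 0 + 700569 * 0 ^ 2) = 0 := by ring
    rw [e] at h
    exact h
  have hc2 : (0 : ℝ) < Real.sqrt gap / 8 := by positivity
  have hc5 : (0 : ℝ) < gap / 128 := by positivity
  filter_upwards [eventually_ge_atTop (0 : ℝ), recordChi_support (L := L) hs hM, Tτu.eventually (gt_mem_nhds one_pos), T2.eventually (gt_mem_nhds hc2),
    Tρ.eventually (gt_mem_nhds (show (0 : ℝ) < 1 / 30 by norm_num)), T5.eventually (gt_mem_nhds hc5), h2τ] with β hβ hsupp h1 h2 h4 h5 h6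
  have herr : P * (1728 * Real.sqrt (powScale (2 * s) β) + 29376 * ρ β + 700569 * ρ β ^ 2) ≤ gap / 128 := by rw [sqrt_powScale_two_mul]; exact h5.le
  refine hsep_of_magnetic hL hβ h1.le h2.le (powScale_le_one (by positivity) β) h4.le herr h6 ?_
  intro U hUT hUχ
  obtain ⟨hlink, -, -, hslow, hact⟩ := hsupp U hUχ
  refine ⟨fun k c => (abs_vecPart_le_norm_sub_one _ c).trans (hslow k), hact, ?_⟩
  obtain ⟨u, x, hx, rfl⟩ := hUT
  rw [slowMean_orthoTube L u hx] at hslow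
  rw [relLinkVec_orthoTube L u hx]
  have hent : ∀ (e : Edge 3 L) (c : Fin 3), |x e c| ≤ (M * 43 + 517 / NS) * powScale s β := fun e c => by
    have h := abs_entry_le_of_links hx hlink hslow e c
    linarith
  have hps0 : 0 < powScale s β := powScale_pos s β
  exact norm_linkEmbed_le_of_entry_le (by positivity) hent

end Summit.QuantumFields.YangMills.Theorems.TwistedTraceScaling.Negative.R59
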